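import Mathlib
import HarnessLib
import HarnessLib.Audit
import Summits.AnomalousDissipation.Statement
import Literature.Analysis.FluidPDE.FractionalNSTorus
import Literature.Analysis.FluidPDE.LerayHopfFrac
import HarnessLib.Audit.Status.Attr

/-!
Route: FrictionOrderLadder

DORMANT since 2026-08-23T03:21:28Z (reconciler: no traction for 5.9 d (last activity item-evidence-added at 2026-08-17T06:02:58Z); parked, not closed — `ledger route dormant route-AnomalousDissipation-FrictionOrderLadder --off` to react) — unstaffed, not closed; items shared with open routes are served there. `ledger route dormant <id> --off` reactivates.

# Route FrictionOrderLadder — AnomalousDissipation (Literature.Turb.ZerothLaw); realises idea card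
friction-order-ladder-onsager-third

## Thesis X (words)
The zeroth law is FRICTION-ROBUST, and the Leray–Hopf bookkeeping is a separate fixed-viscosity
debt.
(A) CleanRoomInjectionFloor. There are a smooth steady divergence-free mean-zero force f,
viscosities ν_j → 0, smooth data u₀ⱼ and
constants μ₀, E, ε > 0, T₀ such that for every j and EVERY hyperviscosity μ ∈ (0, μ₀] a global
classical solution of Lions' clean-room
system ∂ₜu + (u·∇)u + ∇p = ν_jΔu − μΔ²u + f, u(0) = u₀ⱼ (globally well posed and smooth for μ > 0:
Beirão da Veiga 1985 =
LemarieRieusset2016 Thm 18.5; Temam1997 Ch. VIII (4.6); Lions1969) has running-mean energy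
T⁻¹∫₀ᵀ‖u‖₂² ≤ E and running-mean
injection T⁻¹∫₀ᵀ(f,u) ≥ ε for all T ≥ T₀. Along μ the friction interpolates from
hyperviscosity-dominated dynamics (the idea card's
rung α ≥ 5/4, where injection = friction dissipation exactly and weak = strong) down to
Navier–Stokes (μ → 0): this is the card's
upper ladder 5/4 → 1 written as ONE uniform statement inside globally well-posed smooth dynamics.
(B) NoMeanLeakage. At FIXED ν > 0, every global Leray–Hopf solution that is a strong L²_loc limit of
clean-room solutions as μ → 0
("hyperviscosity-selected") satisfies ⟨(f,u)⟩ ≤ ν⟨‖∇u‖²⟩ (limsup means): the selected physical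
solutions do not leak energy in the
mean. (B) is strictly weaker than fixed-ν global regularity and is exactly the regularity content
the summit's ε-form demands.

## Thesis X (Lean, one line; decls of this file, elaborated rc 0 in the planner sketch)
CleanRoomInjectionFloor ∧ NoMeanLeakage

## Assembly X → AnomalousDissipation
Assembly := CleanRoomInjectionFloor → HyperviscousDescent → NoMeanLeakage → AnomalousDissipation.
For each j apply the support
HyperviscousDescent (vanishing-hyperviscosity compactness: Beirão da Veiga 1985 /
LemarieRieusset2016 Thm 18.5 transplanted to T³, plus
passage of running means under strong L²((0,T)×T³) convergence — injection is strongly continuous,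
dissipation is not needed) to get a
global Leray–Hopf u_j from u₀ⱼ with meanEnergy u_j ≤ E and ⟨(f,u_j)⟩ ≥ ε together with its selecting
sequence; NoMeanLeakage turns
the injection floor into meanDissipation (ν j) (u j) ≥ ε; the witnesses of Literature.Turb.ZerothLaw
are (f, ν, u₀, u). The plumbing
is a 10-line term (choice over j + le_trans), checked in Sketch.lean.

Rationale: ## Why this line
The idea card varies the ORDER of the friction operator ν(−Δ)^α and finds decided or clean rungs (α
= 0 false; 2-D false ∀α;
α < 1/3 friction and anomaly decouple, Derosa2018/ColomboDelellisDerosa2018; α ≥ 5/4 = "summit minus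
Leray–Hopf", Lions1969;
α = ∞ Galerkin–Euler + absorber, FrischEtAl2008/Tadmor1989) but honestly claims no arrow Z(α) ⇒
Z(1). This route supplies the
missing arrow by the one device that connects a clean rung to the summit's solution class
RIGOROUSLY: the vanishing-hyperviscosity
selection (BeiraoDaVeiga1985 = LemarieRieusset2016 Thm 18.5: ν(−Δ)+μΔ², unique global smooth
solution for μ > 0, α-uniform L∞L² ∩ L²H¹
bounds, weak limit μ→0 is a suitable Leray–Hopf solution, strong limit if NS is regular; Temam1997
Ch. VIII §4.2 (4.6) treats the
same system as a dissipative dynamical system). Imported areas: dissipative dynamical systems /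
hyperviscous regularisation (PDE),
hyperviscous DNS phenomenology (BorueOrszag1996, HaugenBrandenburg2004, AgrawalEtAl2020: mean
dissipation and inertial range
insensitive to the friction order), Doering–Foias long-time budgets (DoeringFoias2002 §2). What it
buys: the physics crux lives in
a two-parameter family of globally well-posed smooth semiflows with exact balance injection = total
friction dissipation (so
trajectory-wise tools — continuation, rigorous numerics, auxiliary-functional/SOS bounds
ChernyshenkoEtAl2014,
TobascoGoluskinDoering2018 — have a well-defined object at every (ν, μ)), while the Leray–Hopf debt
is isolated as a FIXED-ν
statement about ONE selection principle, strictly weaker than fixed-ν regularity and sharper than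
"energy equality for some family".

## Ranked cruxes
#2 CleanRoomInjectionFloor (hardest, most informative): the friction-robust zeroth law, uniform in μ
∈ (0, μ₀] and T ≥ T₀.
#3 NoMeanLeakage: hyperviscosity-selected Leray–Hopf solutions at fixed ν satisfy ⟨(f,u)⟩ ≤
ν⟨‖∇u‖²⟩.
#4 PureHyperviscousZerothLaw: the card's rung Z(5/4) — ν → 0 zeroth law for classical solutions of
∂ₜu+(u·∇)u+∇p = −ν(−Δ)^{5/4}u+f;
   off the assembly chain: the first test-bed of any positive mechanism and the first zeroth law for
ANY deterministic friction.
Supports: HyperviscousDescent (known-type, on the chain), TwoDNoGoAllOrders (provable calibration: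
the 2-D ladder is false for every
α > 0 by the Alexakis–Doering enstrophy argument — the threshold phenomenon is 3-D),
HypoFlexibleZerothLaw (informal; γ < 1/3
Leray–Hopf rung by convex integration with fixed force; needs the forced fractional Leray–Hopf
definition), AbsorberCascade
(informal; α = ∞ rung with per-N SOS certificates).

## Kill criteria
Refutation of #3 (a hyperviscosity-selected LH solution leaking at positive mean rate at fixed ν)
closes the route AND is a
fixed-ν singularity theorem of independent weight. Refutation of #2 in the form "∀ f, clean-room
injection decorrelates as ν → 0
uniformly in μ" = Neg.Decorrelation transplanted to smooth dynamics: closes the route and every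
injection-based positive route.
#4 refuted alone does not close the route (order 5/4 is critical; the chain uses order 2) but kills
the card's clean-sibling claim.

## Deliberately NOT decomposed yet
Choice of f and data (non-shear, no invariant laminar subspace); quantitative T₀; the μ-uniform
attractor/absorbing-ball lemmas;
low-mode (finite-dimensional) reductions of the injection functional; the forced fractional
Leray–Hopf definition (requested) and
the typed form of the γ < 1/3 rung; Galerkin ODE typing of AbsorberCascade. NOVELTY and BARRIERS:
see the dedicated sections.

Novelty: NOVELTY (planner plancard, 2026-08-15; search-before-claim). Nearest prior art FOUND: (1)
BeiraoDaVeiga1985 = LemarieRieusset2016 §18.3 Thm 18.5 (held, PDF pp.710–711 read): NS + αΔ² has a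
unique global solution for α>0, α-uniform L∞L² ∩ L²H¹ bounds, α_k→0 weak limit is a SUITABLE LERAY
solution, strong L∞L² limit if NS has a strong solution — this IS the support HyperviscousDescent
(finite windows, no long-time means, no zeroth law) and the reason NoMeanLeakage ⇐ fixed-ν
regularity. (2) Temam1997 Ch. VIII §4.2 eq. (4.6) (held, PDF p.442): the same mixed system ε(−Δ)^r −
νΔ as a dissipative dynamical system (inertial manifolds, r large). (3) Hyperviscous zeroth-law
NUMERICS: BorueOrszag1996 ((−Δ)^8 Kolmogorov flow), HaugenBrandenburg2004, AgrawalEtAl2020,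
FrischEtAl2008 (α→∞ = Galerkin truncation, bottleneck) — ν- and order-insensitive ε, no theorem. (4)
Clean-room well-posedness/sharpness: Lions1969, MattinglySinai1999 (held arXiv text p.10: 3-D
results for their α>5/2 = order>5/4), KatzPavlovic2002, LuoTiti2020 (in tree), LiQuZengZhang2022 =
arXiv:2205.10260 (weak-class non-uniqueness even above 5/4: clean room is clean in the ENERGY class
only). (5) Energy-equality side of NoMeanLeakage: RobinsonRodrigoSadowski2016 §4.3 Thm 4.6 (PDF
p.78: equality 'to date unknown for general weak solutions') and notes PDF p.135
(Sather–Serrin/Shinbrot L^rL^s criteria), Shinbrot1974, CKN1982; leakage exists in weaker classes: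
BuckmasterVicol2019AnnMath, CheskidovLuo2022. (6) Card-level pri  [refs: 2205.10260, BeiraoDaVeiga1985, LemarieRieusset2016, Temam1997, BorueOrszag1996, HaugenBrandenburg2004, AgrawalEtAl2020, FrischEtAl2008, Lions1969, MattinglySinai1999, KatzPavlovic2002, LuoTiti2020, LiQuZengZhang2022, RobinsonRodrigoSadowski2016, Shinbrot1974, CKN1982, CheskidovLuo2022, Derosa2018, ColomboDelellisDerosa2018, Cheskidov2008, DoeringFoias2002, Seregin2014, LanthalerMishraParespulido20]

Barriers (technique_class: friction-order-ladder vanishing-hyperviscosity-selection): BARRIERS (catalogue Literature/Barriers/AnomalousDissipation, 18 technique_class blocks read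
2026-08-15; technique_class of this route: friction-order-ladder vanishing-hyperviscosity-selection
lions-clean-room injection-floor fixed-nu-no-leakage long-time-averages).
- Literature.Barriers.AnomalousDissipation.Cheskidov2023_thm21_noDissipationAnomaly: blocks
inferring an ε-form floor for approximants from dissipation of a weak LIMIT. EVADED by direction and
quantity: the chain passes a floor on INJECTION (f,u), which is strongly continuous under the L²_loc
convergence of HyperviscousDescent, from approximants to the limit at FIXED ν; no ν→0 limit object
is used and dissipation is never transferred through a weak limit; the conversion
injection→dissipation is the separate crux NoMeanLeakage.
- Literature.Barriers.AnomalousDissipation.Cheskidov2023_thm13_not_forceRobustNoAnomaly: bites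
no-anomaly statements proved by force-robust energy methods. The chain's items are
positive/witness-type or fixed-ν (NoMeanLeakage is not a ν→0 statement); the one no-go filed,
TwoDNoGoAllOrders, is genuinely 2-component 2-D where the enstrophy method is valid (Cheskidov's Thm
1.3 witnesses are 2½-D with the anomaly on the third component) — outside the barrier's scope; the
kill criterion 'clean-room decorrelation ∀f' IS in the blocked class and a refuter proving it must
use exact steadiness/ν-independence of f (honest non-evasion, as for Neg).
- Literature.Barriers.AnomalousDissipation.BuckmasterV

History (route lifecycle, newest last):
- 2026-08-23T03:21:28Z · DORMANT — reconciler: no traction for 5.9 d (last activity item-evidence-added at 2026-08-17T06:02:58Z); parked, not closed — `ledger route dormant route-AnomalousDissipa (operator:999:2283070)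

sub-problem: AnomalousDissipation · status: dormant · opened planner-plancard-AnomalousDissipation-Anomalo-16e1a20a-0 2026-08-15T11:09:36Z · rev 3 · ledger route-AnomalousDissipation-FrictionOrderLadder
GENERATED by the gate from the ledger (D-0016/17). Provers cite these decls: `theorem foo : Summit.AnomalousDissipation.AnomalousDissipation.Theses.FrictionOrderLadder.<Decl> := …` in Summits/AnomalousDissipation/AnomalousDissipation/Theorems/<Name>.lean.
-/

namespace Summit.AnomalousDissipation.AnomalousDissipation.Theses.FrictionOrderLadder

open scoped BigOperators Topology Manifold Classical MeasureTheory ProbabilityTheory Matrix InnerProductSpace ComplexConjugate ContinuousMap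
open Filter Set Function TopologicalSpace MeasureTheory

attribute [summit_statement] _root_.AnomalousDissipation

open Literature.Turb

/-- item stmt-AnomalousDissipation-2932 · crux · rank 2 · open · by planner
why it might fail: It IS the zeroth law (injection form) made uniform in μ∈(0,μ₀], in j and in T≥T₀: no ν-uniform floor on ⟨(f,u)⟩ nor ν-uniform energy bound E is known for ANY deterministic friction (Doering–Foias: upper bounds only); shear/gravest-mode f laminarise (energy ~ν⁻²); transients may last ~1/ν.
sources: DoeringFoias2002, Cheskidov2023, BrueDeLellis2023, BeiraoDaVeiga1985, LemarieRieusset2016, Temam1997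
[crux, rank 2 — hardest] FRICTION-ROBUST ZEROTH LAW IN LIONS' CLEAN ROOM. ∃ smooth steady div-free
mean-zero f, ν_j→0, smooth div-free mean-zero data u₀ⱼ, μ₀>0, E, ε>0, T₀ such that ∀ j ∀ μ∈(0,μ₀]
some global classical solution of ∂ₜu+(u·∇)u+∇p = ν_jΔu − μΔ²u + f, u(0)=u₀ⱼ (typed as
Torus.IsClassicalNSSolutionOn (Ici 0) (ν j) with the hyperviscosity −μ·fracLaplacian 2 (u t) carried
in the force slot; existence/uniqueness/smoothness for μ>0 is known: BeiraoDaVeiga1985 =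
LemarieRieusset2016 Thm 18.5, Temam1997 VIII.4.2 (4.6), Lions1969) has running means T⁻¹∫₀ᵀ‖u‖₂² ≤ E
and T⁻¹∫₀ᵀ(f,u) ≥ ε for all T ≥ T₀. Injection = ν‖∇u‖²+μ‖Δu‖² + d/dt½‖u‖² exactly, so this is a
floor on TOTAL friction dissipation; deliberately NOT on the viscous share (physically false for μ ≫
ν^{11/8}, where hyperviscosity absorbs the cascade first — the card's rung α≥5/4 regime), so the
statement interpolates the hyperviscous zeroth law (μ fixed, ν→0; DNS: BorueOrszag1996,
HaugenBrandenburg2004, AgrawalEtAl2020) and the summit (μ→0) in one uniform claim. Uniform-in-T form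
(not limsup) is what the μ→0 descent needs. Physics: K41, DoeringFoias2002 §2–3; no known example
for any friction (Cheskidov2023 p.4). -/
@[route_item "route-AnomalousDissipation-FrictionOrderLadder", crux]
def CleanRoomInjectionFloor : Prop :=
  ∃ f : UnitAddTorus (Fin 3) → EuclideanSpace ℝ (Fin 3), Literature.Analysis.FunctionSpaces.Torus.IsSmooth f ∧ Literature.Analysis.FunctionSpaces.Torus.IsDivFree f ∧ Literature.Analysis.FunctionSpaces.Torus.HasZeroMean f ∧ ∃ (ν : ℕ → ℝ) (u₀ : ℕ → UnitAddTorus (Fin 3) → EuclideanSpace ℝ (Fin 3)), (∀ j, 0 < ν j) ∧ Filter.Tendsto ν Filter.atTop (nhds 0) ∧ (∀ j, Literature.Analysis.FunctionSpaces.Torus.IsSmooth (u₀ j) ∧ Literature.Analysis.FunctionSpaces.Torus.IsDivFree (u₀ j) ∧ Literature.Analysis.FunctionSpaces.Torus.HasZeroMean (u₀ j)) ∧ ∃ μ₀ E ε T₀ : ℝ, 0 < μ₀ ∧ 0 < ε ∧ ∀ (j : ℕ) (μ : ℝ), 0 < μ → μ ≤ μ₀ → ∃ (u : ℝ → UnitAddTorus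 (Fin 3) → EuclideanSpace ℝ (Fin 3)) (p : ℝ → UnitAddTorus (Fin 3) → ℝ), Literature.Analysis.FunctionSpaces.Torus.IsClassicalNSSolutionOn (Set.Ici 0) (ν j) (fun t x => f x - μ • Literature.Analysis.FluidPDE.Torus.fracLaplacian (2 : ℝ) (u t) x) u p ∧ u 0 = u₀ j ∧ ∀ T : ℝ, T₀ ≤ T → Literature.Analysis.FluidPDE.timeMean (fun t => MeasureTheory.integral MeasureTheory.volume (fun x => ‖u t x‖ ^ 2)) T ≤ E ∧ ε ≤ Literature.Analysis.FluidPDE.timeMean (fun t => MeasureTheory.integral MeasureTheory.volume (fun x => inner ℝ (f x) (u t x))) T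

/-- item stmt-AnomalousDissipation-2933 · crux · rank 3 · open · by planner
why it might fail: False iff some hyperviscosity-selected Leray–Hopf solution at FIXED ν>0 (smooth steady f, smooth data) has energy defects recurring with positive time density; LH energy equality and eventual regularity under large steady forcing are open (equality only under Serrin/Shinbrot/L⁴L⁴-type bounds).
sources: RobinsonRodrigoSadowski2016, Shinbrot1974, DuchonRobert2000, CKN1982, LemarieRieusset2016, BeiraoDaVeiga1985
[crux, rank 3] NO MEAN LERAY–HOPF LEAKAGE FOR HYPERVISCOSITY-SELECTED SOLUTIONS (fixed ν). ∀ ν>0,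
smooth steady div-free mean-zero f, smooth div-free mean-zero u₀, every global Leray–Hopf u
(Torus.IsGlobalLerayHopf ν f u₀ u) that is a strong L²((0,T)×T³) limit, for every T, of classical
clean-room solutions u_k (ν fixed, hyperviscosities μ_k→0, same data) satisfies longTimeAvgSup (f,u)
≤ meanDissipation ν u. The reverse inequality is the LH energy inequality; equality = mean energy
balance of the selected solution. Implied by fixed-ν global regularity from smooth data (then u_k→u
strongly: LemarieRieusset2016 Thm 18.5 last clause, BeiraoDaVeiga1985) and by any
Serrin/Shinbrot-class bound along the trajectory (RobinsonRodrigoSadowski2016 PDF p.135, §4.3 Thm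
4.6 p.78: equality 'to date unknown for general weak solutions'; Shinbrot1974); strictly weaker than
regularity (zero MEAN defect only). A refutation = LH solutions at fixed ν>0 with an energy sink of
positive time-density. Leakage is real in weaker classes at fixed ν (BuckmasterVicol2019AnnMath;
CheskidovLuo2022), so selection + LH structure is load-bearing. ∀-form over a pinned family: sharper
than Correlation (ii). -/
@[route_item "route-AnomalousDissipation-FrictionOrderLadder", crux]
def NoMeanLeakage : Prop :=
  ∀ (ν : ℝ) (f u₀ : UnitAddTorus (Fin 3) → EuclideanSpace ℝ (Fin 3)) (u : ℝ → UnitAddTorus (Fin 3) → EuclideanSpace ℝ (Fin 3)), 0 < ν → Literature.Analysis.FunctionSpaces.Torus.IsSmooth f → Literature.Analysis.FunctionSpaces.Torus.IsDivFree f → Literature.Analysis.FunctionSpaces.Torus.HasZeroMean f → Literature.Analysis.FunctionSpaces.Torus.IsSmooth u₀ → Literature.Analysis.FunctionSpaces.Torus.IsDivFree u₀ → Literature.Analysis.FunctionSpaces.Torus.HasZeroMean u₀ → Literature.Analysis.FluidPDE.Torus.IsGlobalLerayHopf ν (fun _ => f) u₀ u → (∃ (μs : ℕ → ℝ) (us :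 ℕ → ℝ → UnitAddTorus (Fin 3) → EuclideanSpace ℝ (Fin 3)) (ps : ℕ → ℝ → UnitAddTorus (Fin 3) → ℝ), (∀ k, 0 < μs k) ∧ Filter.Tendsto μs Filter.atTop (nhds 0) ∧ (∀ k, Literature.Analysis.FunctionSpaces.Torus.IsClassicalNSSolutionOn (Set.Ici 0) ν (fun t x => f x - μs k • Literature.Analysis.FluidPDE.Torus.fracLaplacian (2 : ℝ) (us k t) x) (us k) (ps k) ∧ us k 0 = u₀) ∧ ∀ T : ℝ, 0 < T → Filter.Tendsto (fun k => ∫ t in (0 : ℝ)..T, MeasureTheory.integral MeasureTheory.volume (fun x => ‖us k t x - u t x‖ ^ 2)) Filter.atTop (nhds 0)) → Literature.Analysis.FluidPDE.longTimeAvgSup (fun t => MeasureTheory.integral MeasureTheory.volume (fun x => inner ℝ (f x) (u t x))) ≤ Literature.Analysis.FluidPDE.meanDissipation ν u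

/-- item stmt-AnomalousDissipation-2934 · crux · rank 4 · open · by planner
why it might fail: Zeroth law for the order-5/4 hyperviscous fluid: global classical solutions exist (Lions), but a uniform floor inf_j μ_j⟨‖Λ^{5/4}u_j‖²⟩>0 with sup_j⟨‖u_j‖²⟩<∞ is as open as for NS — no mechanism gives a friction-uniform dissipation floor for any deterministic friction; evidence is DNS only.
sources: Lions1969, MattinglySinai1999, KatzPavlovic2002, LuoTiti2020, BorueOrszag1996, HaugenBrandenburg2004
[crux, rank 4 — card rung Z(5/4), F2; off the assembly chain] PURE HYPERVISCOUS ZEROTH LAW AT LIONS'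
EXPONENT. ∃ smooth steady div-free mean-zero f, μ_j→0, global classical solutions (u_j,p_j) of
∂ₜu+(u·∇)u+∇p = −μ_j(−Δ)^{5/4}u + f (viscosity slot 0, −μ_j·fracLaplacian (5/4) (u t) in the force
slot) with sup_j meanEnergy < ∞ and inf_j longTimeAvgSup (μ_j·eFracDissipation (5/4) (u_j t)) > 0.
At order ≥ 5/4 Leray–Hopf = classical (Lions1969 Rem. 6.11; MattinglySinai1999 §3-D for order > 5/4;
KatzPavlovic2002; sharpness of 5/4 in weak classes: LuoTiti2020 =
Literature.Barriers.NavierStokesRegularity.LionsExponentSharpness; even above 5/4 outside the energy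
class: LiQuZengZhang2022): 'the summit minus Leray–Hopf' — injection = friction dissipation exactly,
no leakage clause, no choice of weak solution. Same physics as the summit (ν-independent ε in
hyperviscous DNS: BorueOrszag1996, HaugenBrandenburg2004, AgrawalEtAl2020; inertial range untouched
since 5/4 > 1/3): the recommended FIRST test-bed for every positive mechanism on file, and the first
zeroth law for any deterministic friction if proved. Variant welcome as support: the same statement
for one fixed order α > 5/4. -/
@[route_item "route-AnomalousDissipation-FrictionOrderLadder"]
def PureHyperviscousZerothLaw : Prop :=
  ∃ f : UnitAddTorus (Fin 3) → EuclideanSpace ℝ (Fin 3), Literature.Analysis.FunctionSpaces.Torus.IsSmooth f ∧ Literature.Analysis.FunctionSpaces.Torus.IsDivFree f ∧ Literature.Analysis.FunctionSpaces.Torus.HasZeroMean f ∧ ∃ (μ : ℕ → ℝ) (u : ℕ → ℝ → UnitAddTorus (Fin 3) → EuclideanSpace ℝ (Fin 3)) (p : ℕ → ℝ → UnitAddTorus (Fin 3) → ℝ), (∀ j, 0 < μ j) ∧ Filter.Tendsto μ Filter.atTop (nhds 0) ∧ (∀ j, Literature.Analysis.FunctionSpaces.Torus.IsClassicalNSSolutionOn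 (Set.Ici 0) 0 (fun t x => f x - μ j • Literature.Analysis.FluidPDE.Torus.fracLaplacian (5 / 4 : ℝ) (u j t) x) (u j) (p j)) ∧ (∃ E : ℝ, ∀ j, Literature.Analysis.FluidPDE.meanEnergy (u j) ≤ E) ∧ ∃ ε : ℝ, 0 < ε ∧ ∀ j, ε ≤ Literature.Analysis.FluidPDE.longTimeAvgSup (fun t => μ j * (Literature.Analysis.FluidPDE.Torus.eFracDissipation (5 / 4 : ℝ) (u j t)).toReal)

/-- item stmt-AnomalousDissipation-2935 · support · rank 9 · open · by planner
sources: BeiraoDaVeiga1985, LemarieRieusset2016, Lions1969, Temam1997, RobinsonRodrigoSadowski2016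
[support, rank 9 — on the assembly chain; known-type] VANISHING-HYPERVISCOSITY DESCENT. Fixed ν>0,
smooth steady f, smooth data u₀, constants μ₀, E, ε>0, T₀: if for every μ∈(0,μ₀] some global
classical clean-room solution from u₀ has running-mean energy ≤ E and running-mean injection ≥ ε for
all T ≥ T₀, then some global Leray–Hopf u of NS_ν (force f, datum u₀) is a strong L²((0,T)×T³)-limit
(every T) of such solutions along some μ_k→0, with meanEnergy u ≤ E and ε ≤ longTimeAvgSup (f,u).
Proof map: BeiraoDaVeiga1985 = LemarieRieusset2016 §18.3 Thm 18.5 (ℝ³; same on T³): μ-uniform L∞L² ∩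
L²H¹ bounds, μΔ²u → 0 in L²H⁻², Aubin–Lions ⇒ strong L²_loc compactness, the limit is a (suitable)
Leray–Hopf solution = Torus.IsLerayHopfOn for every T (weak form, energy inequalities by lower
semicontinuity, weak L²-continuity, strong attainment of u₀); running means pass to the limit at
each fixed T since injection and energy are continuous under strong L²((0,T)×T³) convergence (f
bounded); |T⁻¹∫₀ᵀ(f,u)| ≤ ‖f‖₂√E makes limsup ≥ liminf ≥ ε honest. Templates: FracNSGalerkin*,
TorusClassicalLerayHopf*. May be vendored as a Literature named fact and the item restated as (h :
fact) → …. -/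
@[route_item "route-AnomalousDissipation-FrictionOrderLadder", crux]
def HyperviscousDescent : Prop :=
  ∀ (ν μ₀ E ε T₀ : ℝ) (f u₀ : UnitAddTorus (Fin 3) → EuclideanSpace ℝ (Fin 3)), 0 < ν → 0 < μ₀ → 0 < ε → Literature.Analysis.FunctionSpaces.Torus.IsSmooth f → Literature.Analysis.FunctionSpaces.Torus.IsDivFree f → Literature.Analysis.FunctionSpaces.Torus.HasZeroMean f → Literature.Analysis.FunctionSpaces.Torus.IsSmooth u₀ → Literature.Analysis.FunctionSpaces.Torus.IsDivFree u₀ → Literature.Analysis.FunctionSpaces.Torus.HasZeroMean u₀ → (∀ μ : ℝ, 0 < μ → μ ≤ μ₀ → ∃ (u : ℝ → UnitAddTorus (Fin 3) → EuclideanSpace ℝ (Fin 3)) (p : ℝ → UnitAddTorus (Fin 3) → ℝ), Literature.Analysis.FunctionSpaces.Torus.IsClassicalNSSolutionOn (Set.Ici 0) ν (fun t x => f x - μ • Literature.Analysis.FluidPDE.Torus.fracLaplacian (2 : ℝ) (u t) x) u p ∧ u 0 = u₀ ∧ ∀ T : ℝ, T₀ ≤ T → Literature.Analysis.FluidPDE.timeMean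 (fun t => MeasureTheory.integral MeasureTheory.volume (fun x => ‖u t x‖ ^ 2)) T ≤ E ∧ ε ≤ Literature.Analysis.FluidPDE.timeMean (fun t => MeasureTheory.integral MeasureTheory.volume (fun x => inner ℝ (f x) (u t x))) T) → ∃ u : ℝ → UnitAddTorus (Fin 3) → EuclideanSpace ℝ (Fin 3), Literature.Analysis.FluidPDE.Torus.IsGlobalLerayHopf ν (fun _ => f) u₀ u ∧ (∃ (μs : ℕ → ℝ) (us : ℕ → ℝ → UnitAddTorus (Fin 3) → EuclideanSpace ℝ (Fin 3)) (ps : ℕ → ℝ → UnitAddTorus (Fin 3) → ℝ), (∀ k, 0 < μs k) ∧ Filter.Tendsto μs Filter.atTop (nhds 0) ∧ (∀ k, Literature.Analysis.FunctionSpaces.Torus.IsClassicalNSSolutionOn (Set.Ici 0) ν (fun t x => f x - μs k • Literature.Analysis.FluidPDE.Torus.fracLaplacian (2 : ℝ) (us k t) x) (us k) (ps k) ∧ us k 0 = u₀) ∧ ∀ T : ℝ, 0 < T → Filter.Tendsto (fun k => ∫ t in (0 : ℝ)..T, MeasureTheory.integral MeasureTheory.volume (fun x => ‖us k t x - u t x‖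 ^ 2)) Filter.atTop (nhds 0)) ∧ Literature.Analysis.FluidPDE.meanEnergy u ≤ E ∧ ε ≤ Literature.Analysis.FluidPDE.longTimeAvgSup (fun t => MeasureTheory.integral MeasureTheory.volume (fun x => inner ℝ (f x) (u t x)))

/-- item stmt-AnomalousDissipation-2936 · support · rank 9 · open · by planner
sources: AlexakisDoering2006PLA, ConstantinRamos2007, DeRosaPark2024
[support, rank 9 — provable calibration: the friction-order threshold is a 3-D phenomenon] 2-D
LADDER DECIDED. On T², for every order α>0, smooth steady div-free mean-zero f, μ_j→0 and global
classical solutions of ∂ₜu+(u·∇)u+∇p = −μ_j(−Δ)^α u + f (viscosity slot 0, friction in the force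
slot) with sup_j meanEnergy ≤ E: longTimeAvgSup (μ_j·eFracDissipation α (u_j t)) → 0. Proof map
(Alexakis–Doering enstrophy argument at order α): enstrophy balance d/dt½‖ω‖² = −μ‖Λ^α ω‖² + (curl
f, ω), ‖ω(t)‖ bounded at fixed μ (Poincaré), so μ⟨|u|²_{Ḣ^{1+α}}⟩ ≤ ⟨(−Δf, u)⟩ + o_T(1) ≤ ‖Δf‖₂√E;
interpolate Ḣ^α between L² and Ḣ^{1+α} with θ = α/(1+α) and Hölder in time: μ⟨|u|²_{Ḣ^α}⟩ ≤
μ^{1/(1+α)} E^{1/(1+α)} (μ⟨|u|²_{Ḣ^{1+α}}⟩)^{α/(1+α)} ≤ C μ^{1/(1+α)} → 0 (α=1 recovers ε ≲ ν^{1/2},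
AlexakisDoering2006PLA §2 =
Literature.Barriers.AnomalousDissipation.AlexakisDoering2006_energyDissipationBound, discharged in
tree: AlexakisDoeringProofs — the template). limsup bookkeeping as in those files. α=0 (pure drag)
is the trivial rung ε₀ = μ⟨‖u‖²⟩ ≤ μE → 0, valid in every dimension. -/
@[route_item "route-AnomalousDissipation-FrictionOrderLadder"]
def TwoDNoGoAllOrders : Prop :=
  ∀ (α : ℝ), 0 < α → ∀ (f : UnitAddTorus (Fin 2) → EuclideanSpace ℝ (Fin 2)), Literature.Analysis.FunctionSpaces.Torus.IsSmooth f → Literature.Analysis.FunctionSpaces.Torus.IsDivFree f → Literature.Analysis.FunctionSpaces.Torus.HasZeroMean f → ∀ (μ : ℕ → ℝ) (u : ℕ → ℝ → UnitAddTorus (Fin 2) → EuclideanSpace ℝ (Fin 2)) (p : ℕ → ℝ → UnitAddTorus (Fin 2) → ℝ), (∀ j, 0 < μ j) → Filter.Tendsto μ Filter.atTop (nhds 0) → (∀ j, Literature.Analysis.FunctionSpaces.Torus.IsClassicalNSSolutionOn (Set.Ici 0) 0 (fun t x => f x - μ j • Literature.Analysis.FluidPDE.Torus.fracLaplacian α (u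 j t) x) (u j) (p j)) → (∃ E : ℝ, ∀ j, Literature.Analysis.FluidPDE.meanEnergy (u j) ≤ E) → Filter.Tendsto (fun j => Literature.Analysis.FluidPDE.longTimeAvgSup (fun t => μ j * (Literature.Analysis.FluidPDE.Torus.eFracDissipation α (u j t)).toReal)) Filter.atTop (nhds 0)

/-- item stmt-AnomalousDissipation-3088 · support · rank 9 · open · by planner
[support] LOWER RUNG γ < 1/3 (two-sided threshold, flexible half; folded-in cards
alpha-ladder-dissipation-order A1, dissipation-order-ladder-onsager-third,
hypo-parking-fat-shell-gamma-ladder). For every γ ∈ (0, 1/3): the Leray–Hopf zeroth law Z_LH(γ)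
HOLDS — ∃ smooth steady div-free mean-zero f on T³, ν_j → 0, data u₀ⱼ and global FORCED fractional
Leray–Hopf solutions (De Rosa's class: weak solutions of ∂ₜu + div(u⊗u) + ∇p + ν_j(−Δ)^γ u = f with
the energy inequality between ALL pairs 0 ≤ s < t, cf. Torus.IsLerayHopfFracSolution for the
unforced ν = 1 class) with sup_j meanEnergy < ∞ and inf_j longTimeAvgSup (ν_j · eFracDissipation γ
(u_j t)) > 0 — realised by convex integration INSIDE the Leray–Hopf class with a ν-placed
dissipating shell |k| ~ ν_j^{-b} (amplitude² ~ ν_j^{2γb−1}·ε, energy → 0 on that shell; window 2γb <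
1 < ... as in the folded card: γ < β″ < 1/3). Calibration value: shows the summit's Leray–Hopf
quantifier is SOFT below Onsager's third (viscous ε made O(1) for non-physical reasons), i.e. turns
Literature.Barriers.AnomalousDissipation.BuckmasterVicol2019_thm13 into a threshold statement; says
nothing at γ = 1. Needs definition Torus.IsGlobalLerayHopfFrac (reques -/
@[route_item "route-AnomalousDissipation-FrictionOrderLadder"]
def HypoFlexibleZerothLaw : Prop :=
  ∀ γ : ℝ, 0 < γ → γ < 1 / 3 → ∃ f : UnitAddTorus (Fin 3) → EuclideanSpace ℝ (Fin 3), Literature.Analysis.FunctionSpaces.Torus.IsSmooth f ∧ Literature.Analysis.FunctionSpaces.Torus.IsDivFree f ∧ Literature.Analysis.FunctionSpaces.Torus.HasZeroMean f ∧ ∃ (ν : ℕ → ℝ) (u₀ : ℕ → UnitAddTorus (Fin 3) → EuclideanSpace ℝ (Fin 3)) (u : ℕ → ℝ → UnitAddTorus (Fin 3) → EuclideanSpace ℝ (Fin 3)), (∀ j, 0 < ν j) ∧ Filter.Tendsto ν Filter.atTop (nhds 0) ∧ (∀ j, Literature.Analysis.FluidPDE.Torus.IsGlobalLerayHopfFracAllPairs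 γ (ν j) (fun _ => f) (u₀ j) (u j)) ∧ (∃ E : ℝ, ∀ j, Literature.Analysis.FluidPDE.meanEnergy (u j) ≤ E) ∧ ∃ ε : ℝ, 0 < ε ∧ ∀ j, ε ≤ Literature.Analysis.FluidPDE.longTimeAvgSup (fun t => ν j * (Literature.Analysis.FluidPDE.Torus.eFracDissipation γ (u j t)).toReal)

-- item stmt-AnomalousDissipation-3089 · support · rank 9 · open · by planner — informal only, no Lean statement yet:
--   [support] TOP RUNG α = ∞ DONE RIGHT (card F5). Galerkin-truncated Euler on T³ (modes |k| ≤ N) with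
--   steady force f supported in |k| ≤ k_f and a MATCHED ABSORBER −Γ N^{2/3} P_{N/2<|k|≤N} u on the top
--   octave (damping rate ∝ local turnover; Tadmor1989 spectral-vanishing-viscosity philosophy;
--   FrischEtAl2008 / AgrawalEtAl2020: naive α→∞ thermalises). Statement: ∃ f, Γ, ε, E, N₀ such that ∀ N
--   ≥ N₀ the polynomial ODE on ℝ^{~N³} has a time-average (invariant-measure) state with mean energy ≤ E
--   and mean absorbed power Γ N^{2/3}⟨‖P_top u‖²⟩ ≥ ε — the cascade in viscosity-free finite-dimensional
--   form; for

/-- item stmt-AnomalousDissipation-2931 · assembly · rank 1 · open · by planner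
sources: DoeringFoias2002, BeiraoDaVeiga1985
[assembly] Pure plumbing, proved in the planner sketch (Sketch.lean, rc 0): unpack
CleanRoomInjectionFloor into (f, ν, u₀, μ₀, E, ε, T₀, H); for each j feed H j to HyperviscousDescent
at viscosity ν j to obtain a global Leray–Hopf u_j from u₀ j with its selecting sequence, meanEnergy
u_j ≤ E and ε ≤ ⟨(f,u_j)⟩; NoMeanLeakage gives ⟨(f,u_j)⟩ ≤ meanDissipation (ν j) (u j); `choose u
hu`, then the witnesses of Literature.Turb.ZerothLaw = AnomalousDissipation are ⟨f, _, _, _, ν, u₀,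
u, …, ⟨E, _⟩, ε, _, _⟩ with one le_trans. ≤ 15 lines. Sources: DoeringFoias2002 §2 (budget),
BeiraoDaVeiga1985. -/
@[route_item "route-AnomalousDissipation-FrictionOrderLadder"]
def Assembly : Prop :=
  CleanRoomInjectionFloor → HyperviscousDescent → NoMeanLeakage → AnomalousDissipation

/-! D-0027 §2.1 — DECIDING THEOREM (planner-authored via `route open/edit --closes-file`; by planner-rbadge-AnomalousDissipation-FrictionOr-81e8327d-g2-0 2026-08-15T16:11:36Z):
its hypotheses are this route's items and its conclusion the sub-problem Statement (glue_lint), and it elaborates with this file. -/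

@[closes "route-AnomalousDissipation-FrictionOrderLadder"] theorem closes : CleanRoomInjectionFloor → NoMeanLeakage → HyperviscousDescent → _root_.AnomalousDissipation := by
  intro hA hL hD
  obtain ⟨f, hf, hdf, hmf, ν, u₀, hν, hν0, hu₀, μ₀, E, ε, T₀, hμ₀, hε, H⟩ := hA
  have key : ∀ j : ℕ, ∃ u : ℝ → UnitAddTorus (Fin 3) → EuclideanSpace ℝ (Fin 3),
      Literature.Analysis.FluidPDE.Torus.IsGlobalLerayHopf (ν j) (fun _ => f) (u₀ j) u ∧
      Literature.Analysis.FluidPDE.meanEnergy u ≤ E ∧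
      ε ≤ Literature.Analysis.FluidPDE.meanDissipation (ν j) u := by
    intro j
    obtain ⟨u, hLH, hsel, hE, hinj⟩ := hD (ν j) μ₀ E ε T₀ f (u₀ j) (hν j) hμ₀ hε hf hdf hmf
      (hu₀ j).1 (hu₀ j).2.1 (hu₀ j).2.2 (fun μ hμ hμle => H j μ hμ hμle)
    exact ⟨u, hLH, hE, le_trans hinj (hL (ν j) f (u₀ j) u (hν j) hf hdf hmf
      (hu₀ j).1 (hu₀ j).2.1 (hu₀ j).2.2 hLH hsel)⟩
  choose u hu using key
  exact ⟨f, hf, hdf, hmf, ν, u₀, u, hν, hν0, fun j => (hu j).1, ⟨E, fun j => (hu j).2.1⟩, ε, hε,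
    fun j => (hu j).2.2⟩

end Summit.AnomalousDissipation.AnomalousDissipation.Theses.FrictionOrderLadder
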